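import Mathlib
import Summits.NavierStokesRegularity.NavierStokesRegularity.Theorems.HeteroclinicTriggerChainTriggerChainFrontStepTriggerRow
import Summits.NavierStokesRegularity.NavierStokesRegularity.Theorems.HeteroclinicTriggerChainTriggerChainFrontStepLatticeSeed
import HarnessLib

/-!
# `HeteroclinicTriggerChain` — crux `TriggerChainFrontStep` (item stmt-NavierStokesRegularity-22785):
  the `σ`-TRIGGER ROW is linear in the trigger amplitudes (structural bound)

The lattice delay lemma (`…LatticeDelay`) carries the `σ`-trigger-row through a constant `B_σ ≥
|quadTerm 1 σ S i₁ n|`, and its hypothesis "seed above the forcing floor" needs `βB_σ ≪ e·u(0) ≍ eβ`,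
i.e. `B_σ` SMALL. This holds because the seed table `σ` also satisfies the (parity) clause, so its
trigger row is LINEAR in the trigger amplitudes (`htcTR_quadTerm_trigger` applied to `σ`): for any
symmetric `σ` with parity at `i₁` and `|σ| ≤ σ̄`, any family `X` with all amplitudes at shells
`n−1, n, n+1` bounded by `A`,

  `|quadTerm 1 σ X i₁ n| ≤ 8σ̄A·( 2^{5n/2}·(2|u_n| + |u_{n+1}|) + 2^{5(n−1)/2}·|u_{n−1}| )`
  (`htcSG_sigma_trigger_row_abs_le`, `u_m = X_{i₁,m}`),

so on a pre-ignition window (`|u_n| ≤ h`, `|u_{n+1}| ≤ V`, `|u_{n−1}| ≤ ω`) one may take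
`B_σ = 8σ̄A(2^{5n/2}(2h + V) + 2^{5(n−1)/2}ω)` — small with `h`, `V`, `ω`.

HONEST FRAMING: finite algebra of Tao-type MODEL lattice tables (Tao 2016 §4); helper for the crux (no stub
credit); nothing here is a statement about the Navier–Stokes equations; no summit, rung or crux is proved.
-/

noncomputable section

set_option linter.dupNamespace false

open Real Set

namespace Summit.NavierStokesRegularity.NavierStokesRegularity.Theorems

open Literature.Analysis.FluidPDE Literature.Analysis.FluidPDE.TaoCascade

/-- **The `σ`-trigger row is linear in the triggers.** For a symmetric table `σ` with the (parity) clause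
at `i₁`, `|σ| ≤ σ̄`, and a family with `|X_{b,m}| ≤ A` for all modes `b` and `m ∈ {n−1, n, n+1}`:
`|quadTerm 1 σ X i₁ n t| ≤ 8σ̄A(2^{5n/2}(2|X_{i₁,n}| + |X_{i₁,n+1}|) + 2^{5(n−1)/2}|X_{i₁,n−1}|)`.
[this file] -/
theorem htcSG_sigma_trigger_row_abs_le (σ : Fin 4 → Fin 4 → Fin 4 → ℤ × ℤ × ℤ → ℝ) (i₁ : Fin 4)
    (hσsym : IsSymmetricCoeff σ)
    (hσpar : ∀ (j₁ j₂ j₃ : Fin 4) (μ : ℤ × ℤ × ℤ),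
      Xor (Xor (j₁ = i₁) (j₂ = i₁)) (j₃ = i₁) → σ j₁ j₂ j₃ μ = 0)
    {σb A : ℝ} (hσ1 : ∀ a b c μ, |σ a b c μ| ≤ σb)
    (X : Fin 4 → ℤ → ℝ → ℝ) (n : ℤ) (t : ℝ)
    (hA : ∀ b, |X b n t| ≤ A ∧ |X b (n + 1) t| ≤ A ∧ |X b (n - 1) t| ≤ A) :
    |quadTerm 1 σ X i₁ n t| ≤
      8 * σb * A * ((1 + 1 : ℝ) ^ ((5 : ℝ) * n / 2) * (2 * |X i₁ n t| + |X i₁ (n + 1) t|) +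
        (1 + 1 : ℝ) ^ ((5 : ℝ) * ((n : ℝ) - 1) / 2) * |X i₁ (n - 1) t|) := by
  have hσ0 : 0 ≤ σb := (abs_nonneg _).trans (hσ1 i₁ i₁ i₁ (0, 0, 0))
  have hA0 : 0 ≤ A := (abs_nonneg _).trans (hA i₁).1
  have hγ₀ : 0 ≤ (1 + 1 : ℝ) ^ ((5 : ℝ) * n / 2) := Real.rpow_nonneg (by norm_num) _
  have hγ₁ : 0 ≤ (1 + 1 : ℝ) ^ ((5 : ℝ) * ((n : ℝ) - 1) / 2) := Real.rpow_nonneg (by norm_num) _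
  rw [htcTR_quadTerm_trigger σ i₁ hσsym hσpar X n t]
  -- each coefficient sum is bounded by 4 σ̄ A
  have hsum : ∀ (F : Fin 4 → ℝ), (∀ b, |F b| ≤ σb * A) → |∑ b, F b| ≤ 4 * (σb * A) :=
    fun F hF => htcLS_abs_sum_le_four F hF
  have hprod : ∀ (c z : ℝ), |c| ≤ σb → |z| ≤ A → |c * z| ≤ σb * A := fun c z hc hz => by
    rw [abs_mul]; exact mul_le_mul hc hz (abs_nonneg _) hσ0
  have hP₀ : |∑ b, σ i₁ b i₁ (0, 0, 0) * X b n t| ≤ 4 * (σb * A) :=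
    hsum _ fun b => hprod _ _ (hσ1 _ _ _ _) (hA b).1
  have hP₁ : |∑ b, σ i₁ b i₁ (1, 0, 0) * X b n t| ≤ 4 * (σb * A) :=
    hsum _ fun b => hprod _ _ (hσ1 _ _ _ _) (hA b).1
  have hP₂ : |∑ b, σ b i₁ i₁ (1, 0, 0) * X b (n + 1) t| ≤ 4 * (σb * A) :=
    hsum _ fun b => hprod _ _ (hσ1 _ _ _ _) (hA b).2.1
  have hP₃ : |∑ b, σ i₁ b i₁ (0, 0, 1) * X b (n - 1) t| ≤ 4 * (σb * A) :=
    hsum _ fun b => hprod _ _ (hσ1 _ _ _ _) (hA b).2.2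
  set P₀ := ∑ b, σ i₁ b i₁ (0, 0, 0) * X b n t
  set P₁ := ∑ b, σ i₁ b i₁ (1, 0, 0) * X b n t
  set P₂ := ∑ b, σ b i₁ i₁ (1, 0, 0) * X b (n + 1) t
  set P₃ := ∑ b, σ i₁ b i₁ (0, 0, 1) * X b (n - 1) t
  have t1 : |2 * X i₁ n t * P₀| ≤ 2 * |X i₁ n t| * (4 * (σb * A)) := by
    rw [abs_mul, abs_mul, abs_two]
    exact mul_le_mul_of_nonneg_left hP₀ (by positivity)
  have t2 : |2 * X i₁ (n + 1) t * P₁| ≤ 2 * |X i₁ (n + 1) t| * (4 * (σb * A)) := by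
    rw [abs_mul, abs_mul, abs_two]
    exact mul_le_mul_of_nonneg_left hP₁ (by positivity)
  have t3 : |2 * X i₁ n t * P₂| ≤ 2 * |X i₁ n t| * (4 * (σb * A)) := by
    rw [abs_mul, abs_mul, abs_two]
    exact mul_le_mul_of_nonneg_left hP₂ (by positivity)
  have t4 : |2 * X i₁ (n - 1) t * P₃| ≤ 2 * |X i₁ (n - 1) t| * (4 * (σb * A)) := by
    rw [abs_mul, abs_mul, abs_two]
    exact mul_le_mul_of_nonneg_left hP₃ (by positivity)
  have hblock : |2 * X i₁ n t * P₀ + 2 * X i₁ (n + 1) t * P₁ + 2 * X i₁ n t * P₂| ≤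
      8 * σb * A * (2 * |X i₁ n t| + |X i₁ (n + 1) t|) := by
    calc _ ≤ |2 * X i₁ n t * P₀ + 2 * X i₁ (n + 1) t * P₁| + |2 * X i₁ n t * P₂| := abs_add_le _ _
      _ ≤ |2 * X i₁ n t * P₀| + |2 * X i₁ (n + 1) t * P₁| + |2 * X i₁ n t * P₂| := by
          linarith [abs_add_le (2 * X i₁ n t * P₀) (2 * X i₁ (n + 1) t * P₁)]
      _ ≤ _ := by linarith
  calc |(1 + 1 : ℝ) ^ ((5 : ℝ) * n / 2) * (2 * X i₁ n t * P₀ + 2 * X i₁ (n + 1) t * P₁ + 2 * X i₁ n t * P₂) +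
        (1 + 1 : ℝ) ^ ((5 : ℝ) * ((n : ℝ) - 1) / 2) * (2 * X i₁ (n - 1) t * P₃)|
      ≤ |(1 + 1 : ℝ) ^ ((5 : ℝ) * n / 2) * (2 * X i₁ n t * P₀ + 2 * X i₁ (n + 1) t * P₁ + 2 * X i₁ n t * P₂)| +
        |(1 + 1 : ℝ) ^ ((5 : ℝ) * ((n : ℝ) - 1) / 2) * (2 * X i₁ (n - 1) t * P₃)| := abs_add_le _ _
    _ ≤ (1 + 1 : ℝ) ^ ((5 : ℝ) * n / 2) * (8 * σb * A * (2 * |X i₁ n t| + |X i₁ (n + 1) t|)) +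
        (1 + 1 : ℝ) ^ ((5 : ℝ) * ((n : ℝ) - 1) / 2) * (2 * |X i₁ (n - 1) t| * (4 * (σb * A))) := by
        rw [abs_mul, abs_of_nonneg hγ₀, abs_mul, abs_of_nonneg hγ₁]
        exact add_le_add (mul_le_mul_of_nonneg_left hblock hγ₀) (mul_le_mul_of_nonneg_left t4 hγ₁)
    _ = _ := by ring

end Summit.NavierStokesRegularity.NavierStokesRegularity.Theorems

end
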